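import Summits.QuantumFields.YangMills.Theorems.ColdStartUniversalityLatticeLangevinBakryEmeryCurvature
import Summits.QuantumFields.YangMills.Theorems.ColdStartUniversalityLatticeLangevinBakryEmeryPoincareFlow
import HarnessLib

/-!
# Route `ColdStartUniversality` (fixed-cut-off package, Bakry–Émery side): the VOLUME-UNIFORM POINCARÉ INEQUALITY for the Wilson
# measure `μ_{β'}` from a Hessian bound on the plaquette action — `(1 − K₀/2)·Var_μ(F) ≤ ℰ(F)` for all `C³` cylinder functions

Helper file (seat `ym-line-csu-p1`, g25; `--supports stmt-QuantumFields-24809`).  Combines `integral_generator_sq_ge_of_hessBound`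
(Bochner/`Γ₂`: the integrated `CD(1 − K₀/2, ∞)` inequality from the Hessian bound `K₀` of the plaquette function along the noise frame)
with `wilson_generatorPoincare_of_integratedCD_compact` (semigroup proof of Poincaré from integrated `CD(ρ,∞)`) and a cut-off
(the generator and the values of a cylinder function on the group only see the function near the compact range of the coordinates):
  ★★★ `wilson_generatorPoincare_of_hessBound`: if `K₀ < 2` bounds the frame Hessian of `ψ̂ = β'Σ_p Re tr U_p`, then for EVERY
  `L`, every `C³` `f`, `F = f∘coords`:  `(1 − K₀/2) · ∫ (F − μ_(β')F)² dμ_(β') ≤ −∫ (F − μ_(β')F)·𝓛_(β') f dμ_(β')`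
— the generator-form Poincaré inequality (hypothesis `hPgen` of the tree's `L²` decay theorems) with a constant that does NOT depend on
the torus size `L` once `K₀` does not (Shen–Zhu–Zhu, CMP 400 (2023), Theorem 4.2 / Cor. 4.4 (4.11), Poincaré half, for `SU(2)`,
`d = 3`, in the tree's normalisation `Ric = 1`).  The tree's previous fixed-cut-off gap `(3/2)e^(−4|β'|#𝒫)` (Holley–Stroock, g19)
degenerates with the volume; this one does not.
THEOREMS ONLY, no definition, no sorry.  HONEST FRAMING: fixed cut-off, conditional on the Hessian constant `K₀` (made explicit,
`∝ |β'|`, in the sequel); worthless in the route's scaling `β'_K → ∞`; no crux, rung or summit statement is proved; the Yang–Mills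
mass gap is NOT proved.
-/

set_option autoImplicit false

noncomputable section

namespace Summit.QuantumFields.YangMills.Theorems.ColdStartUniversality

open MeasureTheory Matrix Complex Finset Metric Set
open scoped ComplexConjugate BigOperators Matrix
open Literature.MathematicalPhysics.QuantumFieldTheory
open Literature.MathematicalPhysics.QuantumLattice (fundamentalRep fundamentalLatticeRep continuous_fundamentalRep fundamentalRep_apply)

variable {L : ℕ} [NeZero L]

/-- ★★★ **Volume-uniform Poincaré inequality for `μ_(β')` from a Hessian bound** (Bakry–Émery; Shen–Zhu–Zhu Thm 4.2 / Cor. 4.4,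
Poincaré half).  If the frame Hessian of the plaquette function is bounded by `K₀ < 2` times the carré du champ at every configuration,
then `(1 − K₀/2)·∫ (F − μF)² dμ_(β') ≤ −∫ (F − μF)·𝓛f dμ_(β')` for every `C³` function `f` of the real link coordinates.
[cite: ShenZhuZhu2022, §4 Theorem 4.2 and Corollary 4.4 (4.11)] -/
theorem wilson_generatorPoincare_of_hessBound (L : ℕ) [NeZero L] (β' K₀ : ℝ) (hK : K₀ < 2)
    (hHess : (∀ (V : (GaugeConfig 3 L (Matrix.specialUnitaryGroup (Fin 2) ℂ))) (Λ : (Edge 3 L × Fin (fundamentalLatticeRep 2).N × Fin (fundamentalLatticeRep 2).N × Bool → ℝ) →L[ℝ] ℝ),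
      ∑ n : Edge 3 L × NoiseIdx (fundamentalLatticeRep 2).N, ∑ m : Edge 3 L × NoiseIdx (fundamentalLatticeRep 2).N,
        Λ ((fun q : Edge 3 L × Fin (fundamentalLatticeRep 2).N × Fin (fundamentalLatticeRep 2).N × Bool => if n.1 = q.1 then (fun z : ℂ => if q.2.2.2 then z.im else z.re) (((Real.sqrt 2 : ℂ) • ((fundamentalLatticeRep 2).lieProj (noiseDir n.2) * (fun (ee : Edge 3 L) => Matrix.of fun (i j : Fin (fundamentalLatticeRep 2).N) => (((fun (V : GaugeConfig 3 L (Matrix.specialUnitaryGroup (Fin 2) ℂ)) (q : Edge 3 L × Fin (fundamentalLatticeRep 2).N × Fin (fundamentalLatticeRep 2).N × Bool) => (fun z : ℂ => if q.2.2.2 then z.im else z.re) ((fundamentalRep (Fin 2) (V q.1) : Matrix (Fin 2) (Fin 2) ℂ) q.2.1 q.2.2.1)) V (ee, i, j, false) : ℝ) : ℂ) + (((fun (V : GaugeConfig 3 L (Matrix.specialUnitaryGroup (Fin 2) ℂ)) (q : Edge 3 L × Fin (fundamentalLatticeRep 2).N × Fin (fundamentalLatticeRep 2).N × Bool) => (fun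 z : ℂ => if q.2.2.2 then z.im else z.re) ((fundamentalRep (Fin 2) (V q.1) : Matrix (Fin 2) (Fin 2) ℂ) q.2.1 q.2.2.1)) V (ee, i, j, true) : ℝ) : ℂ) * Complex.I) q.1)) q.2.1 q.2.2.1) else 0)) * Λ ((fun q : Edge 3 L × Fin (fundamentalLatticeRep 2).N × Fin (fundamentalLatticeRep 2).N × Bool => if m.1 = q.1 then (fun z : ℂ => if q.2.2.2 then z.im else z.re) (((Real.sqrt 2 : ℂ) • ((fundamentalLatticeRep 2).lieProj (noiseDir m.2) * (fun (ee : Edge 3 L) => Matrix.of fun (i j : Fin (fundamentalLatticeRep 2).N) => (((fun (V : GaugeConfig 3 L (Matrix.specialUnitaryGroup (Fin 2) ℂ)) (q : Edge 3 L × Fin (fundamentalLatticeRep 2).N × Fin (fundamentalLatticeRep 2).N × Bool) => (fun z : ℂ => if q.2.2.2 then z.im else z.re) ((fundamentalRep (Fin 2) (V q.1) : Matrix (Fin 2) (Fin 2) ℂ) q.2.1 q.2.2.1)) V (ee, i, j, false) : ℝ) : ℂ) + (((fun (V : GaugeConfig 3 L (Matrix.specialUnitaryGroup (Fin 2) ℂ))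 (q : Edge 3 L × Fin (fundamentalLatticeRep 2).N × Fin (fundamentalLatticeRep 2).N × Bool) => (fun z : ℂ => if q.2.2.2 then z.im else z.re) ((fundamentalRep (Fin 2) (V q.1) : Matrix (Fin 2) (Fin 2) ℂ) q.2.1 q.2.2.1)) V (ee, i, j, true) : ℝ) : ℂ) * Complex.I) q.1)) q.2.1 q.2.2.1) else 0)) *
          fderiv ℝ (fun z : (Edge 3 L × Fin (fundamentalLatticeRep 2).N × Fin (fundamentalLatticeRep 2).N × Bool → ℝ) => fderiv ℝ (fun y : (Edge 3 L × Fin (fundamentalLatticeRep 2).N × Fin (fundamentalLatticeRep 2).N × Bool → ℝ) => β' * ∑ p : Plaquette 3 L, (rootedLoop (fun (ee : Edge 3 L) (i j : Fin (fundamentalLatticeRep 2).N) => ((y (ee, i, j, false) : ℝ) : ℂ) + ((y (ee, i, j, true) : ℝ) : ℂ) * Complex.I) (p.1, p.2.1.1) p.2.1.2 false).trace.re) z (fun q : Edge 3 L × Fin (fundamentalLatticeRep 2).N × Fin (fundamentalLatticeRep 2).N × Bool => if m.1 = q.1 then (fun z : ℂ => if q.2.2.2 then z.im else z.re) (((Real.sqrt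 2 : ℂ) • ((fundamentalLatticeRep 2).lieProj (noiseDir m.2) * (fun (ee : Edge 3 L) => Matrix.of fun (i j : Fin (fundamentalLatticeRep 2).N) => ((z (ee, i, j, false) : ℝ) : ℂ) + ((z (ee, i, j, true) : ℝ) : ℂ) * Complex.I) q.1)) q.2.1 q.2.2.1) else 0)) ((fun (V : GaugeConfig 3 L (Matrix.specialUnitaryGroup (Fin 2) ℂ)) (q : Edge 3 L × Fin (fundamentalLatticeRep 2).N × Fin (fundamentalLatticeRep 2).N × Bool) => (fun z : ℂ => if q.2.2.2 then z.im else z.re) ((fundamentalRep (Fin 2) (V q.1) : Matrix (Fin 2) (Fin 2) ℂ) q.2.1 q.2.2.1)) V) (fun q : Edge 3 L × Fin (fundamentalLatticeRep 2).N × Fin (fundamentalLatticeRep 2).N × Bool => if n.1 = q.1 then (fun z : ℂ => if q.2.2.2 then z.im else z.re) (((Real.sqrt 2 : ℂ) • ((fundamentalLatticeRep 2).lieProj (noiseDir n.2) * (fun (ee : Edge 3 L) => Matrix.of fun (i j : Fin (fundamentalLatticeRep 2).N) => (((fun (V : GaugeConfig 3 L (Matrix.specialUnitaryGroup (Fin 2)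 ℂ)) (q : Edge 3 L × Fin (fundamentalLatticeRep 2).N × Fin (fundamentalLatticeRep 2).N × Bool) => (fun z : ℂ => if q.2.2.2 then z.im else z.re) ((fundamentalRep (Fin 2) (V q.1) : Matrix (Fin 2) (Fin 2) ℂ) q.2.1 q.2.2.1)) V (ee, i, j, false) : ℝ) : ℂ) + (((fun (V : GaugeConfig 3 L (Matrix.specialUnitaryGroup (Fin 2) ℂ)) (q : Edge 3 L × Fin (fundamentalLatticeRep 2).N × Fin (fundamentalLatticeRep 2).N × Bool) => (fun z : ℂ => if q.2.2.2 then z.im else z.re) ((fundamentalRep (Fin 2) (V q.1) : Matrix (Fin 2) (Fin 2) ℂ) q.2.1 q.2.2.1)) V (ee, i, j, true) : ℝ) : ℂ) * Complex.I) q.1)) q.2.1 q.2.2.1) else 0)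
        ≤ K₀ * ∑ n : Edge 3 L × NoiseIdx (fundamentalLatticeRep 2).N, (Λ (fun q : Edge 3 L × Fin (fundamentalLatticeRep 2).N × Fin (fundamentalLatticeRep 2).N × Bool => if n.1 = q.1 then (fun z : ℂ => if q.2.2.2 then z.im else z.re) (((Real.sqrt 2 : ℂ) • ((fundamentalLatticeRep 2).lieProj (noiseDir n.2) * (fun (ee : Edge 3 L) => Matrix.of fun (i j : Fin (fundamentalLatticeRep 2).N) => (((fun (V : GaugeConfig 3 L (Matrix.specialUnitaryGroup (Fin 2) ℂ)) (q : Edge 3 L × Fin (fundamentalLatticeRep 2).N × Fin (fundamentalLatticeRep 2).N × Bool) => (fun z : ℂ => if q.2.2.2 then z.im else z.re) ((fundamentalRep (Fin 2) (V q.1) : Matrix (Fin 2) (Fin 2) ℂ) q.2.1 q.2.2.1)) V (ee, i, j, false) : ℝ) : ℂ) + (((fun (V : GaugeConfig 3 L (Matrix.specialUnitaryGroup (Fin 2) ℂ)) (q : Edge 3 L × Fin (fundamentalLatticeRep 2).N × Fin (fundamentalLatticeRep 2).N × Bool) => (fun z : ℂ => if q.2.2.2 then z.im else z.re) ((fundamentalRep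 (Fin 2) (V q.1) : Matrix (Fin 2) (Fin 2) ℂ) q.2.1 q.2.2.1)) V (ee, i, j, true) : ℝ) : ℂ) * Complex.I) q.1)) q.2.1 q.2.2.1) else 0)) ^ 2))
    (f : (Edge 3 L × Fin 2 × Fin 2 × Bool → ℝ) → ℝ) (hf : ContDiff ℝ 3 f) :
    let coords : GaugeConfig 3 L (Matrix.specialUnitaryGroup (Fin 2) ℂ) → (Edge 3 L × Fin 2 × Fin 2 × Bool → ℝ) :=
      fun V q => (fun z : ℂ => if q.2.2.2 then z.im else z.re)
        ((fundamentalRep (Fin 2) (V q.1) : Matrix (Fin 2) (Fin 2) ℂ) q.2.1 q.2.2.1)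
    let gen : ((Edge 3 L × Fin 2 × Fin 2 × Bool → ℝ) → ℝ) → GaugeConfig 3 L (Matrix.specialUnitaryGroup (Fin 2) ℂ) → ℝ :=
      fun h V =>
      (∑ i : Edge 3 L × Fin 2 × Fin 2 × Bool, fderiv ℝ h (coords V) (Pi.single i 1) *
          (fun z : ℂ => if i.2.2.2 then z.im else z.re)
            ((latticeLangevinDynamics (fundamentalLatticeRep 2) β').drift
              (matrixConfig (fundamentalRep (Fin 2)) V) i.1 i.2.1 i.2.2.1) +
      1 / 2 * ∑ i : Edge 3 L × Fin 2 × Fin 2 × Bool, ∑ j : Edge 3 L × Fin 2 × Fin 2 × Bool,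
        fderiv ℝ (fun z => fderiv ℝ h z (Pi.single i 1)) (coords V) (Pi.single j 1) *
          ∑ n : Edge 3 L × NoiseIdx 2,
            (if n.1 = i.1 then (fun z : ℂ => if i.2.2.2 then z.im else z.re)
              ((latticeLangevinDynamics (fundamentalLatticeRep 2) β').noise
                (matrixConfig (fundamentalRep (Fin 2)) V) i.1 n.2 i.2.1 i.2.2.1) else 0) *
            (if n.1 = j.1 then (fun z : ℂ => if j.2.2.2 then z.im else z.re)
              ((latticeLangevinDynamics (fundamentalLatticeRep 2) β').noise
                (matrixConfig (fundamentalRep (Fin 2)) V) j.1 n.2 j.2.1 j.2.2.1) else 0))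
    (1 - K₀ / 2) * ∫ V, (f (coords V) - ∫ V', f (coords V') ∂(wilsonMeasure (d := 3) (L := L) (fundamentalRep (Fin 2)) β')) ^ 2 ∂(wilsonMeasure (d := 3) (L := L) (fundamentalRep (Fin 2)) β') ≤
      -∫ V, (f (coords V) - ∫ V', f (coords V') ∂(wilsonMeasure (d := 3) (L := L) (fundamentalRep (Fin 2)) β')) * gen f V ∂(wilsonMeasure (d := 3) (L := L) (fundamentalRep (Fin 2)) β') := by
  intro coords gen
  classical
  have hρ : 0 < 1 - K₀ / 2 := by linarith
  -- the integrated curvature inequality for every compactly supported `C³` function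
  have hICD : ∀ (g : (Edge 3 L × Fin 2 × Fin 2 × Bool → ℝ) → ℝ), ContDiff ℝ 3 g → HasCompactSupport g →
      (1 - K₀ / 2) * (-∫ V, g (coords V) * gen g V ∂(wilsonMeasure (d := 3) (L := L) (fundamentalRep (Fin 2)) β')) ≤ ∫ V, (gen g V) ^ 2 ∂(wilsonMeasure (d := 3) (L := L) (fundamentalRep (Fin 2)) β') :=
    fun g hg _ => integral_generator_sq_ge_of_hessBound L β' K₀ hHess g hg
  -- cut-off: `f₁ = χ·f` agrees with `f` near the (bounded) range of the coordinates
  let χ : ContDiffBump (0 : (Edge 3 L × Fin 2 × Fin 2 × Bool → ℝ)) := ⟨2, 3, by norm_num, by norm_num⟩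
  set f₁ : (Edge 3 L × Fin 2 × Fin 2 × Bool → ℝ) → ℝ := fun y => (χ : (Edge 3 L × Fin 2 × Fin 2 × Bool → ℝ) → ℝ) y * f y with hf₁def
  have hf₁ : ContDiff ℝ 3 f₁ := χ.contDiff.mul hf
  have hf₁c : HasCompactSupport f₁ := χ.hasCompactSupport.mul_right
  have hball : ∀ V : (GaugeConfig 3 L (Matrix.specialUnitaryGroup (Fin 2) ℂ)), coords V ∈ ball (0 : (Edge 3 L × Fin 2 × Fin 2 × Bool → ℝ)) 2 := by
    intro V
    rw [mem_ball, dist_zero_right]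
    exact (norm_coords_le_one V).trans_lt (by norm_num)
  have hfeq : ∀ y ∈ ball (0 : (Edge 3 L × Fin 2 × Fin 2 × Bool → ℝ)) 2, f₁ y = f y := by
    intro y hy
    have h1 : (χ : (Edge 3 L × Fin 2 × Fin 2 × Bool → ℝ) → ℝ) y = 1 := χ.one_of_mem_closedBall (ball_subset_closedBall hy)
    simp only [hf₁def, h1, one_mul]
  have hfev : ∀ y ∈ ball (0 : (Edge 3 L × Fin 2 × Fin 2 × Bool → ℝ)) 2, f₁ =ᶠ[nhds y] f := fun y hy =>
    Filter.eventually_of_mem (isOpen_ball.mem_nhds hy) hfeq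
  have hval : ∀ V : (GaugeConfig 3 L (Matrix.specialUnitaryGroup (Fin 2) ℂ)), f₁ (coords V) = f (coords V) := fun V => hfeq _ (hball V)
  have hC1 : ∀ V : (GaugeConfig 3 L (Matrix.specialUnitaryGroup (Fin 2) ℂ)), fderiv ℝ f₁ (coords V) = fderiv ℝ f (coords V) := fun V => (hfev _ (hball V)).fderiv_eq
  have hC2 : ∀ (V : (GaugeConfig 3 L (Matrix.specialUnitaryGroup (Fin 2) ℂ))) (v : (Edge 3 L × Fin 2 × Fin 2 × Bool → ℝ)), fderiv ℝ (fun z => fderiv ℝ f₁ z v) (coords V) =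
      fderiv ℝ (fun z => fderiv ℝ f z v) (coords V) := by
    intro V v
    refine Filter.EventuallyEq.fderiv_eq ?_
    filter_upwards [isOpen_ball.mem_nhds (hball V)] with z hz
    rw [(hfev z hz).fderiv_eq]
  have hgen : ∀ V : (GaugeConfig 3 L (Matrix.specialUnitaryGroup (Fin 2) ℂ)), gen f₁ V = gen f V := by
    intro V
    simp only [gen, hC1 V, hC2 V]
  -- Poincaré for `f₁`, transported to `f`
  have hP : (1 - K₀ / 2) * ∫ V, (f₁ (coords V) - ∫ V', f₁ (coords V') ∂(wilsonMeasure (d := 3) (L := L) (fundamentalRep (Fin 2)) β')) ^ 2 ∂(wilsonMeasure (d := 3) (L := L) (fundamentalRep (Fin 2)) β') ≤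
      -∫ V, (f₁ (coords V) - ∫ V', f₁ (coords V') ∂(wilsonMeasure (d := 3) (L := L) (fundamentalRep (Fin 2)) β')) * gen f₁ V ∂(wilsonMeasure (d := 3) (L := L) (fundamentalRep (Fin 2)) β') :=
    wilson_generatorPoincare_of_integratedCD_compact L β' (1 - K₀ / 2) hρ hICD hf₁ hf₁c
  simp only [hval, hgen] at hP
  exact hP

end Summit.QuantumFields.YangMills.Theorems.ColdStartUniversality
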